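import Mathlib
import HarnessLib

/-!
# Route `KLProgramme` — crux K3, VL child `KLRegimeVolumeLimitV17F3` (stmt-HubbardSuperconductivity-23356), producer route «(VL)-SRC-SOFT» §S5c-2a:
# THE FIVE ROWS OF THE TWO-SCALE STEP HOLD FOR SMALL `(λ_max, t₀)` — one explicit smallness `ε·(64(Φ̄+1)(eτ+1)²(σ+1)(R+1)²(C₀Q₁ + C₀Q₁² + 1)) ≤ 1`
# once the per-pair constant dominates the alive law, `16Φ̄τC₀Q₁² ≤ R` (seat hubbard-kl-k3c4-p1 g19; `--supports` 23356)

Pure real arithmetic: the rows `hx₂ hx₁ hx₃ hw hV` of `…TwoVolumeSrcTowerInduction.sourceProfilesAtLev_allLevels` at data `(C₀, Q₁, 2t₀, 2t₀)`, uniformly in the block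
constant `Φ ≤ Φ̄`, from `λ_max, t₀ ≤ ε`.  Every term is a sub-monomial of `m = (Φ̄+1)(eτ+1)²(σ+1)(R+1)²(C₀Q₁ + C₀Q₁² + 1)` times `ε` (so `≤ 1/64`), except the alive
degree-≥2 mass `2ΦτC₀Q₁²/R ≤ 1/8`, which is what the choice of `R` pays for.
* **`twoScale_rows_of_small`**.
Nothing about the model is asserted; nothing asserts any stub, VL, K3 or superconductivity. [folklore: real arithmetic; cite: BenfattoGiulianiMastropietro2006, §2.8 (2.83)]
-/

noncomputable section

namespace Summit.HubbardSuperconductivity.HubbardSuperconductivity.Theorems.TwoVolumeDefect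

set_option linter.dupNamespace false -- summit = problem name (single-conjunct summit), D-0017

open Real

/-- **The five rows of T2₂ at `(C₀, Q₁, 2t₀, 2t₀)` from one smallness** (see the module docstring). [folklore] -/
theorem twoScale_rows_of_small {Φb Φ τ σ C₀ Q₁ R ε lam t₀ : ℝ} (hΦ0 : 0 ≤ Φ) (hΦ : Φ ≤ Φb) (hτ : 0 ≤ τ) (hσ : 0 ≤ σ) (hC₀ : 0 ≤ C₀) (hQ₁ : 0 ≤ Q₁)
    (hR1 : 1 ≤ R) (hRbig : 16 * Φb * τ * (C₀ * Q₁ ^ 2) ≤ R) (hε0 : 0 ≤ ε)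
    (hε : ε * (64 * (Φb + 1) * (Real.exp 1 * τ + 1) ^ 2 * (σ + 1) * (R + 1) ^ 2 * (C₀ * Q₁ + C₀ * Q₁ ^ 2 + 1)) ≤ 1)
    (hlam0 : 0 ≤ lam) (hlam : lam ≤ ε) (ht0 : 0 ≤ t₀) (ht : t₀ ≤ ε) (ht1 : t₀ ≤ 1) :
    2 * lam * τ * R ≤ 1 ∧ 4 * σ * lam * R ≤ 1 / 2 ∧ Real.exp 1 * τ * lam * R ≤ 1 / 2 ∧
    Φ * (2 * τ * R * (lam * (C₀ * Q₁ / (2 * R) + 2 * t₀ / 2) + (2 * t₀ / (2 * R) + C₀ * (Q₁ / R) ^ 2 + 2 * t₀))) ≤ 1 / 2 ∧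
    Φ * (Real.exp 1 * τ * (lam * (C₀ * Q₁ + 2 * t₀ * R) + 2 * t₀) + 4 * lam * (Real.exp 1 * τ) ^ 2 * (C₀ * Q₁ ^ 2 + 2 * t₀ * R ^ 2)) ≤ 1 / 2 := by
  have he1 : 1 ≤ Real.exp 1 := Real.one_le_exp (by norm_num)
  have hR0 : 0 < R := lt_of_lt_of_le one_pos hR1
  have hΦb0 : 0 ≤ Φb := hΦ0.trans hΦ
  -- the master monomial
  set P : ℝ := Φb + 1 with hP
  set E : ℝ := Real.exp 1 * τ + 1 with hE
  set S : ℝ := σ + 1 with hS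
  set B : ℝ := R + 1 with hB
  set D : ℝ := C₀ * Q₁ + C₀ * Q₁ ^ 2 + 1 with hD
  have hP1 : 1 ≤ P := by rw [hP]; linarith
  have heτ0 : 0 ≤ Real.exp 1 * τ := by positivity
  have hE1 : 1 ≤ E := by rw [hE]; linarith
  have hS1 : 1 ≤ S := by rw [hS]; linarith
  have hB1 : 1 ≤ B := by rw [hB]; linarith
  have hCQ0 : 0 ≤ C₀ * Q₁ := mul_nonneg hC₀ hQ₁
  have hCQ20 : 0 ≤ C₀ * Q₁ ^ 2 := mul_nonneg hC₀ (sq_nonneg Q₁)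
  have hD1 : 1 ≤ D := by rw [hD]; linarith
  have hP0 : 0 ≤ P := zero_le_one.trans hP1
  have hE0 : 0 ≤ E := zero_le_one.trans hE1
  have hS0 : 0 ≤ S := zero_le_one.trans hS1
  have hB0 : 0 ≤ B := zero_le_one.trans hB1
  have hD0 : 0 ≤ D := zero_le_one.trans hD1
  set m : ℝ := P * E ^ 2 * S * B ^ 2 * D with hm
  have hm0 : 0 ≤ m := by positivity
  have hεm : ε * m ≤ 1 / 64 := by
    have : ε * (64 * (Φb + 1) * (Real.exp 1 * τ + 1) ^ 2 * (σ + 1) * (R + 1) ^ 2 * (C₀ * Q₁ + C₀ * Q₁ ^ 2 + 1)) = 64 * (ε * m) := by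
      rw [hm, hP, hE, hS, hB, hD]; ring
    linarith
  -- dominations of the atoms
  have hΦP : Φ ≤ P := hΦ.trans (by rw [hP]; linarith)
  have hτE : τ ≤ E := by rw [hE]; linarith [le_mul_of_one_le_left hτ he1]
  have heτE : Real.exp 1 * τ ≤ E := by rw [hE]; linarith
  have hσS : σ ≤ S := by rw [hS]; linarith
  have hRB : R ≤ B := by rw [hB]; linarith
  have hCQD : C₀ * Q₁ ≤ D := by rw [hD]; linarith
  have hCQ2D : C₀ * Q₁ ^ 2 ≤ D := by rw [hD]; linarith
  -- sub-monomials are `≤ m`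
  have sub1 : E * B ≤ m := by
    have h : m = (E * B) * (P * E * S * B * D) := by rw [hm]; ring
    rw [h]; exact le_mul_of_one_le_right (by positivity)
      (one_le_mul_of_one_le_of_one_le (one_le_mul_of_one_le_of_one_le (one_le_mul_of_one_le_of_one_le (one_le_mul_of_one_le_of_one_le hP1 hE1) hS1) hB1) hD1)
  have sub2 : S * B ≤ m := by
    have h : m = (S * B) * (P * E ^ 2 * B * D) := by rw [hm]; ring
    rw [h]; exact le_mul_of_one_le_right (by positivity)
      (one_le_mul_of_one_le_of_one_le (one_le_mul_of_one_le_of_one_le (one_le_mul_of_one_le_of_one_le hP1 (one_le_pow₀ hE1)) hB1) hD1)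
  have sub3 : P * E * D ≤ m := by
    have h : m = (P * E * D) * (E * S * B ^ 2) := by rw [hm]; ring
    rw [h]; exact le_mul_of_one_le_right (by positivity)
      (one_le_mul_of_one_le_of_one_le (one_le_mul_of_one_le_of_one_le hE1 hS1) (one_le_pow₀ hB1))
  have sub4 : P * E * B ≤ m := by
    have h : m = (P * E * B) * (E * S * B * D) := by rw [hm]; ring
    rw [h]; exact le_mul_of_one_le_right (by positivity)
      (one_le_mul_of_one_le_of_one_le (one_le_mul_of_one_le_of_one_le (one_le_mul_of_one_le_of_one_le hE1 hS1) hB1) hD1)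
  have sub5 : P * E ≤ m := by
    have h : m = (P * E) * (E * S * B ^ 2 * D) := by rw [hm]; ring
    rw [h]; exact le_mul_of_one_le_right (by positivity)
      (one_le_mul_of_one_le_of_one_le (one_le_mul_of_one_le_of_one_le (one_le_mul_of_one_le_of_one_le hE1 hS1) (one_le_pow₀ hB1)) hD1)
  have sub6 : P * E ^ 2 * D ≤ m := by
    have h : m = (P * E ^ 2 * D) * (S * B ^ 2) := by rw [hm]; ring
    rw [h]; exact le_mul_of_one_le_right (by positivity) (one_le_mul_of_one_le_of_one_le hS1 (one_le_pow₀ hB1))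
  have sub7 : P * E ^ 2 * B ^ 2 ≤ m := by
    have h : m = (P * E ^ 2 * B ^ 2) * (S * D) := by rw [hm]; ring
    rw [h]; exact le_mul_of_one_le_right (by positivity) (one_le_mul_of_one_le_of_one_le hS1 hD1)
  -- generic: a term `≤ X·ε` with `X ≤ m` is `≤ 1/64`
  have key : ∀ {T X : ℝ}, T ≤ X * ε → X ≤ m → T ≤ 1 / 64 := fun hT hX =>
    hT.trans ((mul_le_mul_of_nonneg_right hX hε0).trans (by rw [mul_comm]; exact hεm))
  -- the five rows
  have r1 : 2 * lam * τ * R ≤ 1 := by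
    have h : lam * τ * R ≤ 1 / 64 := key (by
      calc lam * τ * R = (τ * R) * lam := by ring
        _ ≤ (E * B) * ε := mul_le_mul (mul_le_mul hτE hRB hR0.le hE0) hlam hlam0 (by positivity)) sub1
    linarith
  have r2 : 4 * σ * lam * R ≤ 1 / 2 := by
    have h : σ * lam * R ≤ 1 / 64 := key (by
      calc σ * lam * R = (σ * R) * lam := by ring
        _ ≤ (S * B) * ε := mul_le_mul (mul_le_mul hσS hRB hR0.le hS0) hlam hlam0 (by positivity)) sub2
    linarith
  have r3 : Real.exp 1 * τ * lam * R ≤ 1 / 2 := by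
    have h : Real.exp 1 * τ * lam * R ≤ 1 / 64 := key (by
      calc Real.exp 1 * τ * lam * R = (Real.exp 1 * τ * R) * lam := by ring
        _ ≤ (E * B) * ε := mul_le_mul (mul_le_mul heτE hRB hR0.le hE0) hlam hlam0 (by positivity)) sub1
    linarith
  -- the alive degree-≥2 mass
  have halive : 2 * Φ * τ * (C₀ * Q₁ ^ 2) / R ≤ 1 / 8 := by
    rw [div_le_iff₀ hR0]
    have : Φ * τ * (C₀ * Q₁ ^ 2) ≤ Φb * τ * (C₀ * Q₁ ^ 2) := by gcongr
    linarith
  have hΦτ : Φ * τ ≤ P * E := mul_le_mul hΦP hτE hτ hP0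
  have r4 : Φ * (2 * τ * R * (lam * (C₀ * Q₁ / (2 * R) + 2 * t₀ / 2) + (2 * t₀ / (2 * R) + C₀ * (Q₁ / R) ^ 2 + 2 * t₀))) ≤ 1 / 2 := by
    have hexp : Φ * (2 * τ * R * (lam * (C₀ * Q₁ / (2 * R) + 2 * t₀ / 2) + (2 * t₀ / (2 * R) + C₀ * (Q₁ / R) ^ 2 + 2 * t₀))) =
        (Φ * τ) * (C₀ * Q₁) * lam + 2 * ((Φ * τ) * R) * (lam * t₀) + 2 * (Φ * τ) * t₀ + 2 * Φ * τ * (C₀ * Q₁ ^ 2) / R + 4 * ((Φ * τ) * R) * t₀ := by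
      field_simp
      ring
    rw [hexp]
    have hlt : lam * t₀ ≤ ε := (mul_le_mul hlam ht1 ht0 hε0).trans_eq (mul_one ε)
    have a1 : (Φ * τ) * (C₀ * Q₁) * lam ≤ 1 / 64 := key (by
      calc (Φ * τ) * (C₀ * Q₁) * lam ≤ (P * E) * D * ε := mul_le_mul (mul_le_mul hΦτ hCQD (by positivity) (by positivity)) hlam hlam0 (by positivity)
        _ = (P * E * D) * ε := by ring) sub3
    have a2 : ((Φ * τ) * R) * (lam * t₀) ≤ 1 / 64 := key (by
      calc ((Φ * τ) * R) * (lam * t₀) ≤ (P * E * B) * ε := mul_le_mul (mul_le_mul hΦτ hRB hR0.le (by positivity)) hlt (by positivity) (by positivity)) sub4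
    have a3 : (Φ * τ) * t₀ ≤ 1 / 64 := key (by
      calc (Φ * τ) * t₀ ≤ (P * E) * ε := mul_le_mul hΦτ ht ht0 (by positivity)) sub5
    have a5 : ((Φ * τ) * R) * t₀ ≤ 1 / 64 := key (by
      calc ((Φ * τ) * R) * t₀ ≤ (P * E * B) * ε := mul_le_mul (mul_le_mul hΦτ hRB hR0.le (by positivity)) ht ht0 (by positivity)) sub4
    linarith
  have r5 : Φ * (Real.exp 1 * τ * (lam * (C₀ * Q₁ + 2 * t₀ * R) + 2 * t₀) + 4 * lam * (Real.exp 1 * τ) ^ 2 * (C₀ * Q₁ ^ 2 + 2 * t₀ * R ^ 2)) ≤ 1 / 2 := by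
    have hexp : Φ * (Real.exp 1 * τ * (lam * (C₀ * Q₁ + 2 * t₀ * R) + 2 * t₀) + 4 * lam * (Real.exp 1 * τ) ^ 2 * (C₀ * Q₁ ^ 2 + 2 * t₀ * R ^ 2)) =
        (Φ * (Real.exp 1 * τ)) * (C₀ * Q₁) * lam + 2 * ((Φ * (Real.exp 1 * τ)) * R) * (lam * t₀) + 2 * (Φ * (Real.exp 1 * τ)) * t₀ +
          4 * ((Φ * (Real.exp 1 * τ) ^ 2) * (C₀ * Q₁ ^ 2)) * lam + 8 * ((Φ * (Real.exp 1 * τ) ^ 2) * R ^ 2) * (lam * t₀) := by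
      ring
    rw [hexp]
    have hlt : lam * t₀ ≤ ε := (mul_le_mul hlam ht1 ht0 hε0).trans_eq (mul_one ε)
    have hΦe : Φ * (Real.exp 1 * τ) ≤ P * E := mul_le_mul hΦP heτE (by positivity) hP0
    have hΦe2 : Φ * (Real.exp 1 * τ) ^ 2 ≤ P * E ^ 2 := mul_le_mul hΦP (pow_le_pow_left₀ (by positivity) heτE 2) (by positivity) hP0
    have b1 : (Φ * (Real.exp 1 * τ)) * (C₀ * Q₁) * lam ≤ 1 / 64 := key (by
      calc (Φ * (Real.exp 1 * τ)) * (C₀ * Q₁) * lam ≤ (P * E) * D * ε := mul_le_mul (mul_le_mul hΦe hCQD (by positivity) (by positivity)) hlam hlam0 (by positivity)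
        _ = (P * E * D) * ε := by ring) sub3
    have b2 : ((Φ * (Real.exp 1 * τ)) * R) * (lam * t₀) ≤ 1 / 64 := key (by
      calc ((Φ * (Real.exp 1 * τ)) * R) * (lam * t₀) ≤ (P * E * B) * ε := mul_le_mul (mul_le_mul hΦe hRB hR0.le (by positivity)) hlt (by positivity) (by positivity))
      sub4
    have b3 : (Φ * (Real.exp 1 * τ)) * t₀ ≤ 1 / 64 := key (by
      calc (Φ * (Real.exp 1 * τ)) * t₀ ≤ (P * E) * ε := mul_le_mul hΦe ht ht0 (by positivity)) sub5
    have b4 : ((Φ * (Real.exp 1 * τ) ^ 2) * (C₀ * Q₁ ^ 2)) * lam ≤ 1 / 64 := key (by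
      calc ((Φ * (Real.exp 1 * τ) ^ 2) * (C₀ * Q₁ ^ 2)) * lam ≤ (P * E ^ 2 * D) * ε :=
          mul_le_mul (by calc (Φ * (Real.exp 1 * τ) ^ 2) * (C₀ * Q₁ ^ 2) ≤ (P * E ^ 2) * D := mul_le_mul hΦe2 hCQ2D (by positivity) (by positivity)
            _ = P * E ^ 2 * D := by ring) hlam hlam0 (by positivity)) sub6
    have b5 : ((Φ * (Real.exp 1 * τ) ^ 2) * R ^ 2) * (lam * t₀) ≤ 1 / 64 := key (by
      calc ((Φ * (Real.exp 1 * τ) ^ 2) * R ^ 2) * (lam * t₀) ≤ (P * E ^ 2 * B ^ 2) * ε :=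
          mul_le_mul (by calc (Φ * (Real.exp 1 * τ) ^ 2) * R ^ 2 ≤ (P * E ^ 2) * B ^ 2 := mul_le_mul hΦe2 (pow_le_pow_left₀ hR0.le hRB 2) (by positivity) (by positivity)
            _ = P * E ^ 2 * B ^ 2 := by ring) hlt (by positivity) (by positivity)) sub7
    linarith
  exact ⟨r1, r2, r3, r4, r5⟩

end Summit.HubbardSuperconductivity.HubbardSuperconductivity.Theorems.TwoVolumeDefect

end
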